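import Literature.Analysis.FluidPDE.NSGalerkinFourier

/-!
# Route WindLine — support item `WindLineReachesCalm` (stmt-AnomalousDissipation-11420), III:
# the windy shore — uniqueness of windy steady Galerkin states at large wind

Helper file (no route declaration is asserted here). On a finite frequency set `S ∋ 0` write a
coefficient vector as wind plus wake, `c̄ = δ₀ ⊗ c₀ + č` (`c₀ = c 0` the momentum, `č` the calm part).
In the convection symbol the wind acts diagonally and the wake never feeds back on the wind:

* `convectionCoeff_single_right` — `convectionCoeff S c (δ₀ ⊗ w) = 0` (`c_l · 0 = 0`);
* `convectionCoeff_single_left` — `convectionCoeff S (δ₀ ⊗ w) c k = (2πi (w · k)) • c k` for `k ∈ S`.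

Consequently two zeros `c, c'` of `galerkinRHS S ν g` with the SAME momentum `w` differ by a calm
`δ = c - c'` solving, mode by mode (`galerkin_mode_identity`),
`(ν·4π²|k|² + 2πi (w · k)) δ_k = -Π_k (B(δ, č)_k + B(č', δ)_k)`.
For a real wind `w = s e` with `e` NON-RESONANT on `S ∖ 0` (`e · k ≠ 0`) the multiplier has modulus
`≥ 2π|s| min |e · k|` WHATEVER `ν ∈ ℝ`, while the right-hand side is `O(ρ ‖δ‖)` on wakes bounded by `ρ`;
hence (`eq_of_galerkinRHS_eq_of_wind_ge`) there is `s₁ = s₁(S, e, ρ)` such that for `|s| ≥ s₁` two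
transversal zeros with momentum `s e` and wakes bounded by `ρ` coincide — the uniqueness half of the
route's ν-uniform windy shore (`WindyShoreUniform`), in the form consumed by `WindLineReachesCalm`.

Sources: the contraction/uniqueness argument for small-data steady Navier–Stokes (Temam 1979, Ch. II,
Thm. 1.3; Constantin–Foias 1988, Ch. 9) run in the dispersive normal operator
`Λ_k = 4π²ν|k|² + 2πi s (e·k)` of the tree's `marchioroDriftState`
(`Literature/Barriers/AnomalousDissipation/GravestModeLaminarAttractorSwept.lean`); folklore at this level.
-/

-- `Summit.<Summit>.<Problem>` is the tree's mandated summit-side namespace (CONVENTIONS §2); for this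
-- single-conjunct summit the two coincide, so the duplicate is deliberate.
set_option linter.dupNamespace false

noncomputable section

open scoped BigOperators InnerProductSpace ComplexConjugate
open Set Function Complex

namespace Summit.AnomalousDissipation.AnomalousDissipation.Theorems.WindLineReachesCalm

open Literature.Analysis.FunctionSpaces Literature.Analysis.FunctionSpaces.Torus
open Literature.Analysis.FluidPDE Literature.Analysis.FluidPDE.Torus

variable {d : Type*} [Fintype d] {S : Finset (d → ℤ)}

/-! ## §1 The wind in the convection symbol -/

/-- **The wake never drives the wind**: the convection symbol vanishes when its second argument is
supported on the mean mode, `convectionCoeff S c (δ₀ ⊗ w) k = ∑_{l + 0 = k} 2πi (c_l · 0) • w = 0`. [folklore] -/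
theorem convectionCoeff_single_right (c : (d → ℤ) → EuclideanSpace ℂ d) (w : EuclideanSpace ℂ d)
    (k : d → ℤ) : convectionCoeff S c (Pi.single 0 w) k = 0 := by
  rw [convectionCoeff_def]
  refine Finset.sum_eq_zero fun l _ => Finset.sum_eq_zero fun m _ => ?_
  split_ifs with h
  · by_cases hm : m = 0
    · subst hm
      simp
    · rw [Pi.single_eq_of_ne hm, smul_zero]
  · rfl

/-- **The wind acts diagonally**: for `0 ∈ S` and `k ∈ S`,
`convectionCoeff S (δ₀ ⊗ w) c k = (2πi ∑ⱼ wⱼ kⱼ) • c k` (only the term `l = 0`, `m = k` survives) —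
the Fourier symbol `2πi (w · k)` of the drift `(w · ∇)`. [folklore] -/
theorem convectionCoeff_single_left (h0 : (0 : d → ℤ) ∈ S) (w : EuclideanSpace ℂ d)
    (c : (d → ℤ) → EuclideanSpace ℂ d) {k : d → ℤ} (hk : k ∈ S) :
    convectionCoeff S (Pi.single 0 w) c k = (2 * Real.pi * I * ∑ j, w j * (k j : ℂ)) • c k := by
  rw [convectionCoeff_def, Finset.sum_eq_single_of_mem (0 : d → ℤ) h0]
  · rw [Finset.sum_eq_single_of_mem k hk]
    · rw [if_pos (zero_add k), Pi.single_eq_same]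
    · intro m _ hmk
      rw [if_neg (by rwa [zero_add])]
  · intro l _ hl
    refine Finset.sum_eq_zero fun m _ => ?_
    split_ifs
    · rw [Pi.single_eq_of_ne hl]
      simp
    · rfl

/-! ## §2 The mode-by-mode identity for the difference of two states with the same momentum -/

/-- Difference of the Galerkin field at two states: for coefficient vectors `c, c'` with
`galerkinRHS S ν g c = galerkinRHS S ν g c'` and `δ̄ = c̄ - c̄'` (bars: extension by zero),
`ν·4π²|k|² δ̄_k + Π_k (B(δ̄, c̄)_k + B(c̄', δ̄)_k) = 0` at every `k ∈ S`
(`B(c̄, c̄) - B(c̄', c̄') = B(δ̄, c̄) + B(c̄', δ̄)`). [folklore] -/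
theorem galerkin_difference_identity (ν : ℝ) {g c c' : ↥S → EuclideanSpace ℂ d}
    (heq : galerkinRHS S ν g c = galerkinRHS S ν g c') (k : ↥S) :
    (((ν * (4 * Real.pi ^ 2 * freqNormSq (k : d → ℤ))) : ℝ) : ℂ) • coeffExt S (c - c') k +
      leraySym (k : d → ℤ)
        (convectionCoeff S (coeffExt S (c - c')) (coeffExt S c) k +
          convectionCoeff S (coeffExt S c') (coeffExt S (c - c')) k) = 0 := by
  classical
  have h := congrFun heq k
  rw [galerkinRHS_apply, galerkinRHS_apply, galerkinField_def, galerkinField_def, leraySym_sub,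
    leraySym_sub] at h
  rw [coeffExt_sub, ← convectionCoeff_self_sub_self, leraySym_sub, Pi.sub_apply, smul_sub]
  set a : ℂ := (((ν * (4 * Real.pi ^ 2 * freqNormSq (k : d → ℤ))) : ℝ) : ℂ) with ha
  calc a • coeffExt S c k - a • coeffExt S c' k +
        (leraySym (k : d → ℤ) (convectionCoeff S (coeffExt S c) (coeffExt S c) k) -
          leraySym (k : d → ℤ) (convectionCoeff S (coeffExt S c') (coeffExt S c') k))
      = (-(a • coeffExt S c' k) + (leraySym (k : d → ℤ) (coeffExt S g k) -
            leraySym (k : d → ℤ) (convectionCoeff S (coeffExt S c') (coeffExt S c') k))) -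
          (-(a • coeffExt S c k) + (leraySym (k : d → ℤ) (coeffExt S g k) -
            leraySym (k : d → ℤ) (convectionCoeff S (coeffExt S c) (coeffExt S c) k))) := by
        abel
    _ = 0 := by rw [h, sub_self]

/-- **Mode-by-mode identity for the difference of two states.** Let `0 ∈ S`, let `c, c'` be
transversal coefficient vectors with `galerkinRHS S ν g c = galerkinRHS S ν g c'`, let `w = c 0` be
the momentum of `c`, and write `č = c̄ - δ₀ ⊗ w`, `č' = c̄' - δ₀ ⊗ w` and `δ̄ = c̄ - c̄'` (when also
`c' 0 = w`, `č'` is the wake of `c'` and `δ̄` is calm). Then at every `k ∈ S`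
`(ν·4π²|k|² + 2πi (w · k)) δ̄_k = -Π_k (B(δ̄, č)_k + B(č', δ̄)_k)`:
the wind is a diagonal, purely dispersive multiplier and the wake enters only bilinearly. [folklore] -/
theorem galerkin_mode_identity (ν : ℝ) (h0 : (0 : d → ℤ) ∈ S) {g c c' : ↥S → EuclideanSpace ℂ d}
    (hc : IsSolenoidalCoeff c) (hc' : IsSolenoidalCoeff c')
    (heq : galerkinRHS S ν g c = galerkinRHS S ν g c') (k : ↥S) :
    ((((ν * (4 * Real.pi ^ 2 * freqNormSq (k : d → ℤ))) : ℝ) : ℂ) +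
        2 * Real.pi * I * ∑ j, c ⟨0, h0⟩ j * ((k : d → ℤ) j : ℂ)) • coeffExt S (c - c') k =
      -leraySym (k : d → ℤ)
        (convectionCoeff S (coeffExt S (c - c')) (coeffExt S c - Pi.single 0 (c ⟨0, h0⟩)) k +
          convectionCoeff S (coeffExt S c' - Pi.single 0 (c ⟨0, h0⟩)) (coeffExt S (c - c')) k) := by
  have h3 := galerkin_difference_identity ν heq k
  have hcdec : coeffExt S c = Pi.single 0 (c ⟨0, h0⟩) + (coeffExt S c - Pi.single 0 (c ⟨0, h0⟩)) :=
    (add_sub_cancel _ _).symm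
  have hcdec' : coeffExt S c' =
      Pi.single 0 (c ⟨0, h0⟩) + (coeffExt S c' - Pi.single 0 (c ⟨0, h0⟩)) :=
    (add_sub_cancel _ _).symm
  have hδT : ∑ i, ((k : d → ℤ) i : ℂ) * coeffExt S (c - c') k i = 0 := by
    rw [coeffExt_sub, Pi.sub_apply]
    simp only [PiLp.sub_apply, mul_sub, Finset.sum_sub_distrib]
    rw [coeffExt_coe, coeffExt_coe, hc k, hc' k, sub_zero]
  conv at h3 =>
    rw [hcdec]
    rw [convectionCoeff_add_right, convectionCoeff_single_right, zero_add]
  rw [hcdec', convectionCoeff_add_left, convectionCoeff_single_left h0 _ _ k.2, leraySym_add,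
    leraySym_add, leraySym_smul, leraySym_of_transversal hδT] at h3
  rw [leraySym_add, add_smul]
  refine eq_neg_of_add_eq_zero_left ?_
  rw [show ∀ A B X Y : EuclideanSpace ℂ d, A + B + (X + Y) = A + (X + (B + Y)) from
    fun A B X Y => by abel]
  convert h3 using 6

/-! ## §3 Uniqueness at large wind -/

/-- A non-resonant direction has a positive resonance gap on the finite set `S ∖ 0`:
`|e · k| ≥ m₀ > 0` for every nonzero `k ∈ S`. [folklore] -/
theorem exists_resonance_gap (e : EuclideanSpace ℝ d)
    (he : ∀ k : ↥S, (k : d → ℤ) ≠ 0 → ∑ i, e i * ((k : d → ℤ) i : ℝ) ≠ 0) :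
    ∃ m₀ : ℝ, 0 < m₀ ∧ ∀ k : ↥S, (k : d → ℤ) ≠ 0 → m₀ ≤ |∑ i, e i * ((k : d → ℤ) i : ℝ)| := by
  classical
  set T : Finset ↥S := Finset.univ.filter fun k : ↥S => (k : d → ℤ) ≠ 0 with hT
  rcases T.eq_empty_or_nonempty with hTe | hTn
  · refine ⟨1, one_pos, fun k hk => ?_⟩
    have hkT : k ∈ T := Finset.mem_filter.2 ⟨Finset.mem_univ _, hk⟩
    rw [hTe] at hkT
    exact absurd hkT (Finset.notMem_empty _)
  · obtain ⟨k₁, hk₁, hmin⟩ :=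
      Finset.exists_min_image T (fun k : ↥S => |∑ i, e i * ((k : d → ℤ) i : ℝ)|) hTn
    exact ⟨_, abs_pos.2 (he k₁ (Finset.mem_filter.1 hk₁).2), fun k hk =>
      hmin k (Finset.mem_filter.2 ⟨Finset.mem_univ _, hk⟩)⟩

/-- The wake of a coefficient vector whose calm coordinates are bounded by `ρ ≥ 0` is bounded by `ρ`
at every frequency. [folklore] -/
theorem norm_wake_le (h0 : (0 : d → ℤ) ∈ S) {c : ↥S → EuclideanSpace ℂ d} {ρ : ℝ} (hρ : 0 ≤ ρ)
    (hb : ∀ k : ↥S, (k : d → ℤ) ≠ 0 → ‖c k‖ ≤ ρ) (m : d → ℤ) :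
    ‖(coeffExt S c - Pi.single (0 : d → ℤ) (c ⟨0, h0⟩) : (d → ℤ) → EuclideanSpace ℂ d) m‖ ≤ ρ := by
  classical
  rw [Pi.sub_apply]
  by_cases hm : m = 0
  · subst hm
    rw [coeffExt_of_mem c h0, Pi.single_eq_same, sub_self, norm_zero]
    exact hρ
  · rw [Pi.single_eq_of_ne hm, sub_zero]
    by_cases hmS : m ∈ S
    · rw [coeffExt_of_mem c hmS]
      exact hb ⟨m, hmS⟩ hm
    · rw [coeffExt_of_not_mem c hmS, norm_zero]
      exact hρ

/-- **Uniqueness of windy steady Galerkin states at large wind** (the uniqueness half of the ν-uniform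
windy shore). Let `0 ∈ S`, let `e` be non-resonant on `S ∖ 0`, and `ρ ≥ 0`. There is `s₁` such that for
every real `ν`, every force vector `g`, and every `|s| ≥ s₁`: two transversal coefficient vectors `c, c'`
with momentum `c 0 = c' 0 = s e`, calm coordinates bounded by `ρ`, and
`galerkinRHS S ν g c = galerkinRHS S ν g c'` (e.g. two windy steady states) are EQUAL. Proof:
`galerkin_mode_identity` gives `|2π s (e·k)| ‖δ_k‖ ≤ ‖(ν4π²|k|² + 2πi s e·k) δ_k‖ ≤ 2Kρ ‖δ‖_∞`
with `K = 2π #S ∑_{m∈S} ∑ⱼ |mⱼ|` (`norm_convectionCoeff_le`), so `‖δ‖_∞ ≤ (Kρ / (π m₀ |s|)) ‖δ‖_∞ < ‖δ‖_∞`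
unless `δ = 0`, once `|s| > Kρ/(π m₀)` (`m₀` the resonance gap). [folklore] -/
theorem eq_of_galerkinRHS_eq_of_wind_ge (h0 : (0 : d → ℤ) ∈ S) (e : EuclideanSpace ℝ d)
    (he : ∀ k : ↥S, (k : d → ℤ) ≠ 0 → ∑ i, e i * ((k : d → ℤ) i : ℝ) ≠ 0) {ρ : ℝ} (hρ : 0 ≤ ρ) :
    ∃ s₁ : ℝ, ∀ (ν : ℝ) (g : ↥S → EuclideanSpace ℂ d) (s : ℝ), s₁ ≤ |s| →
      ∀ c c' : ↥S → EuclideanSpace ℂ d, IsSolenoidalCoeff c → IsSolenoidalCoeff c' →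
        c ⟨0, h0⟩ = (s : ℂ) • EuclideanSpace.complexify e →
        c' ⟨0, h0⟩ = (s : ℂ) • EuclideanSpace.complexify e →
        (∀ k : ↥S, (k : d → ℤ) ≠ 0 → ‖c k‖ ≤ ρ) → (∀ k : ↥S, (k : d → ℤ) ≠ 0 → ‖c' k‖ ≤ ρ) →
        galerkinRHS S ν g c = galerkinRHS S ν g c' → c = c' := by
  obtain ⟨m₀, hm₀, hgap⟩ := exists_resonance_gap e he
  -- the constant of the crude convection bound
  set K : ℝ := 2 * Real.pi * (S.card * ∑ m ∈ S, ∑ j, |(m j : ℝ)|) with hK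
  have hK0 : 0 ≤ K := by positivity
  refine ⟨K * ρ / (Real.pi * m₀) + 1, ?_⟩
  intro ν g s hs c c' hc hc' hc0 hc'0 hb hb' heq
  have hπm : 0 < Real.pi * m₀ := by positivity
  have hs0 : 0 < |s| := lt_of_lt_of_le (by positivity) hs
  have hθ : K * ρ / (Real.pi * m₀ * |s|) < 1 := by
    rw [div_lt_one (by positivity)]
    have h1 : K * ρ / (Real.pi * m₀) < |s| := by linarith
    rw [div_lt_iff₀ hπm] at h1
    linarith
  -- the difference and the per-mode estimate
  set δ : ↥S → EuclideanSpace ℂ d := c - c' with hδ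
  have hw : c ⟨0, h0⟩ = c' ⟨0, h0⟩ := by rw [hc0, hc'0]
  have hmode : ∀ k : ↥S, 2 * Real.pi * m₀ * |s| * ‖δ k‖ ≤ 2 * K * ρ * ‖δ‖ := by
    intro k
    by_cases hk : (k : d → ℤ) = 0
    · have hk' : k = ⟨0, h0⟩ := Subtype.ext hk
      have : δ k = 0 := by rw [hk', hδ, Pi.sub_apply, hw, sub_self]
      rw [this, norm_zero, mul_zero]
      positivity
    have hid := galerkin_mode_identity ν h0 hc hc' heq k
    -- the multiplier is `ν4π²|k|² + 2πi s (e·k)`, of modulus `≥ 2π |s| |e·k| ≥ 2π |s| m₀`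
    have hsum : ∑ j, c ⟨0, h0⟩ j * ((k : d → ℤ) j : ℂ) =
        ((s * ∑ i, e i * ((k : d → ℤ) i : ℝ) : ℝ) : ℂ) := by
      rw [hc0]
      push_cast
      rw [Finset.mul_sum]
      refine Finset.sum_congr rfl fun j _ => ?_
      rw [PiLp.smul_apply, EuclideanSpace.complexify_apply, smul_eq_mul]
      ring
    set μ : ℂ := (((ν * (4 * Real.pi ^ 2 * freqNormSq (k : d → ℤ))) : ℝ) : ℂ) +
      2 * Real.pi * I * ∑ j, c ⟨0, h0⟩ j * ((k : d → ℤ) j : ℂ) with hμ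
    have hμ' : μ = (((ν * (4 * Real.pi ^ 2 * freqNormSq (k : d → ℤ))) : ℝ) : ℂ) +
        ((2 * Real.pi * (s * ∑ i, e i * ((k : d → ℤ) i : ℝ)) : ℝ) : ℂ) * I := by
      rw [hμ, hsum]
      push_cast
      ring
    have hμim : μ.im = 2 * Real.pi * (s * ∑ i, e i * ((k : d → ℤ) i : ℝ)) := by
      rw [hμ']
      simp only [Complex.add_im, Complex.ofReal_im, Complex.mul_I_im, Complex.ofReal_re, zero_add]
    have hμnorm : 2 * Real.pi * m₀ * |s| ≤ ‖μ‖ := by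
      refine le_trans ?_ (Complex.abs_im_le_norm μ)
      rw [hμim, abs_mul, abs_of_pos (by positivity : (0 : ℝ) < 2 * Real.pi), abs_mul]
      have := hgap k hk
      calc 2 * Real.pi * m₀ * |s| = 2 * Real.pi * (|s| * m₀) := by ring
        _ ≤ 2 * Real.pi * (|s| * |∑ i, e i * ((k : d → ℤ) i : ℝ)|) := by gcongr
    -- the right-hand side is `O(ρ ‖δ‖)`
    have hδl : ∀ l ∈ S, ‖coeffExt S (c - c') l‖ ≤ ‖δ‖ := fun l _ => norm_coeffExt_le _ l
    have hR : ‖leraySym (k : d → ℤ)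
        (convectionCoeff S (coeffExt S (c - c')) (coeffExt S c - Pi.single 0 (c ⟨0, h0⟩)) k +
          convectionCoeff S (coeffExt S c' - Pi.single 0 (c ⟨0, h0⟩)) (coeffExt S (c - c')) k)‖ ≤
        2 * K * ρ * ‖δ‖ := by
      refine (norm_leraySym_le _ _).trans ((norm_add_le _ _).trans ?_)
      have h1 := norm_convectionCoeff_le S hδl (fun m _ => norm_wake_le h0 hρ hb m) (k : d → ℤ)
      have hb'w : ∀ m ∈ S,
          ‖(coeffExt S c' - Pi.single (0 : d → ℤ) (c ⟨0, h0⟩) : (d → ℤ) → EuclideanSpace ℂ d) m‖ ≤ ρ :=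
        fun m _ => by rw [hw]; exact norm_wake_le h0 hρ hb' m
      have h2 := norm_convectionCoeff_le S hb'w hδl (k : d → ℤ)
      rw [← hK] at h1 h2
      calc _ ≤ K * ‖δ‖ * ρ + K * ρ * ‖δ‖ := add_le_add h1 h2
        _ = 2 * K * ρ * ‖δ‖ := by ring
    have hnorm : ‖μ • coeffExt S (c - c') k‖ ≤ 2 * K * ρ * ‖δ‖ := by
      rw [hid, norm_neg]
      exact hR
    rw [norm_smul, coeffExt_coe] at hnorm
    calc 2 * Real.pi * m₀ * |s| * ‖δ k‖ ≤ ‖μ‖ * ‖δ k‖ :=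
          mul_le_mul_of_nonneg_right hμnorm (norm_nonneg _)
      _ ≤ 2 * K * ρ * ‖δ‖ := hnorm
  -- `‖δ‖ ≤ θ ‖δ‖` with `θ < 1`
  have hsup : ‖δ‖ ≤ K * ρ / (Real.pi * m₀ * |s|) * ‖δ‖ := by
    refine (pi_norm_le_iff_of_nonneg (by positivity)).2 fun k => ?_
    have h := hmode k
    rw [div_mul_eq_mul_div, le_div_iff₀ (by positivity)]
    calc ‖δ k‖ * (Real.pi * m₀ * |s|) = (2 * Real.pi * m₀ * |s| * ‖δ k‖) / 2 := by ring
      _ ≤ (2 * K * ρ * ‖δ‖) / 2 := by gcongr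
      _ = K * ρ * ‖δ‖ := by ring
  have hδ0 : ‖δ‖ ≤ 0 := by
    by_contra hpos
    push Not at hpos
    have : K * ρ / (Real.pi * m₀ * |s|) * ‖δ‖ < 1 * ‖δ‖ := mul_lt_mul_of_pos_right hθ hpos
    linarith
  have : δ = 0 := norm_le_zero_iff.1 hδ0
  rw [hδ] at this
  exact sub_eq_zero.1 this

end Summit.AnomalousDissipation.AnomalousDissipation.Theorems.WindLineReachesCalm

end
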